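import Summits.ValiantsHypothesis.ValiantsHypothesis.Theorems.GrenetZeonDualUnipotentThreeHalvesHeavyTopCompositionBoundFiveSeven

/-!
# `GrenetZeon.DualUnipotentThreeHalves` (stmt-ValiantsHypothesis-24318), R2 `HeavyTopLaw` — instrument kernel row
# «§8 enumerator soundness», LAYER 3e: the SIZE-GENERAL three-datum composition bound
# (`HeavyTopInst n m` from bounds on irreducible nilpotent spaces of sizes `m`, `m − 1`, `m − 2` alone)

The template of ✓ `heavyTopInst_four_six_of_iota` / `…five_seven_of_iota7` / `…six_nine_of_iota` made uniform in the format.  Let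
`m ≥ 4` and let `β₀, β₁, β₂` bound the dimension of IRREDUCIBLE nilpotent linear subspaces of `M_m(ℂ)`, `M_{m−1}(ℂ)`, `M_{m−2}(ℂ)`.
Take the composition chain of `W = ℂ·N(0) + N_lin(ℂ^{n×n})` in matrix clothes (✓ `exists_block_conj`) and its cut profile
`a t = #{i : lvl i < t}`.
* If some cut has `2 ≤ a t ≤ m − 2`, COARSEN there to two levels: Gerstenhaber on both blocks (✓ `flagCheap_of_invariant_levels`)
  costs `2n + C(a,2) + C(m−a,2)` — hypothesis `hcoarse` says this is `< n²` for every such `a`.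
* Otherwise every cut is `≤ 1` or `≥ m − 1`, so the composition is `(m)`, `(1,m−1)`, `(m−1,1)` or `(1,m−2,1)` and ✓
  `flagCheap_of_block_dims` costs `n + β₀`, `2n + β₁`, `2n + β₁`, `3n + β₂` (unit blocks cost `C(1,2) = 0`).

* `heavyTopInst_of_iota_bounds` — the general statement (hypotheses: the four budgets and the three `ι`-type bounds).
* `heavyTopInst_of_iota_bound` — the same with `β₁ = C(m−1,2) − 1`, `β₂ = C(m−2,2) − 1` discharged by the TRIVIAL irreducible bound
  (✓ `finrank_le_choose_two_sub_one_of_irreducible`): ONE datum `ι(m) ≤ β₀` decides the format.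
* `heavyTopInst_of_trivial_bounds` — all three bounds trivial: a purely ARITHMETIC sufficient condition for `HeavyTopInst n m`
  (it decides e.g. `(15,21)`, the boundary of the quadratic band, see `…HeavyTopInstFifteenTwentyOne`).
* `add_choose_two`, `choose_two_add_choose_two_sub_le` — `C(a,2) + C(m−a,2) ≤ 1 + C(m−2,2)`: the coarsening budget in closed form;
  `heavyTopInst_of_trivial_bounds'`, `heavyTopInst_of_iota_bound'` — the closed-form variants (four numeral inequalities).

HONEST LABEL: size-general BOOKKEEPING over Theorem G and Gerstenhaber's theorem; each use is an instance row of R2 — conditional when a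
`β` is an open `ι`-value, unconditional when the trivial bounds pay.  Nothing here proves `HeavyTopLaw`, 24318, S3b; `VP ≠ VNP` is NOT
proved; no summit statement is proved here.  No definitions, no named facts.  [folklore bookkeeping over Theorem G; cell val-heavytop-census]
-/

noncomputable section

-- single-conjunct layout: Sub = Summit, duplicated namespace component intended
set_option linter.dupNamespace false

namespace Summit.ValiantsHypothesis.ValiantsHypothesis.Theorems.GrenetZeon.HeavyTopCompositionBound

open MvPolynomial Matrix
open scoped BigOperators
open Summit.ValiantsHypothesis.ValiantsHypothesis.Cruxes.TwoDimCoefficients.DimTwoCases (AffMat IsAffine)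
open Summit.ValiantsHypothesis.ValiantsHypothesis.Theorems.GrenetZeon.RadicalSplit
open Summit.ValiantsHypothesis.ValiantsHypothesis.Theorems.GrenetZeon.HeavyTopInvariantFlag (flagCheap_of_invariant_levels)
open Literature.LinearAlgebra.Matrix.GerstenhaberNilpotentSubspace (finrank_le_choose_two)

/-! ## §1 The size-general three-datum composition bound -/

set_option maxHeartbeats 1600000 in
/-- **`HeavyTopInst n m` from three irreducible-dimension data** (`m ≥ 4`).  Hypotheses: `hcoarse` — every two-level coarsening at a cut
`2 ≤ a ≤ m − 2` is affordable, `2n + C(a,2) + C(m−a,2) < n²`; `h₀/h₁/h₂` — the compositions `(m)`, `(1,m−1)`/`(m−1,1)`, `(1,m−2,1)` are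
affordable with the bounds `β₀/β₁/β₂`; `hι₀/hι₁/hι₂` — every IRREDUCIBLE nilpotent linear subspace of `M_m(ℂ)`/`M_{m−1}(ℂ)`/`M_{m−2}(ℂ)` has
dimension `≤ β₀/β₁/β₂`.  The heavy-top hypothesis of `HeavyTopInst` is not used. [folklore bookkeeping over Theorem G] -/
theorem heavyTopInst_of_iota_bounds {n m : ℕ} (hm : 4 ≤ m) (β₀ β₁ β₂ : ℕ)
    (hcoarse : ∀ a : ℕ, 2 ≤ a → a + 2 ≤ m → 2 * n + a.choose 2 + (m - a).choose 2 < n ^ 2)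
    (h₀ : n + β₀ < n ^ 2) (h₁ : 2 * n + β₁ < n ^ 2) (h₂ : 3 * n + β₂ < n ^ 2)
    (hι₀ : ∀ V : Submodule ℂ (Matrix (Fin m) (Fin m) ℂ), (∀ A ∈ V, IsNilpotent A) →
      (∀ U : Submodule ℂ (Fin m → ℂ), (∀ A ∈ V, ∀ x ∈ U, A *ᵥ x ∈ U) → U = ⊥ ∨ U = ⊤) →
      Module.finrank ℂ V ≤ β₀)
    (hι₁ : ∀ V : Submodule ℂ (Matrix (Fin (m - 1)) (Fin (m - 1)) ℂ), (∀ A ∈ V, IsNilpotent A) →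
      (∀ U : Submodule ℂ (Fin (m - 1) → ℂ), (∀ A ∈ V, ∀ x ∈ U, A *ᵥ x ∈ U) → U = ⊥ ∨ U = ⊤) →
      Module.finrank ℂ V ≤ β₁)
    (hι₂ : ∀ V : Submodule ℂ (Matrix (Fin (m - 2)) (Fin (m - 2)) ℂ), (∀ A ∈ V, IsNilpotent A) →
      (∀ U : Submodule ℂ (Fin (m - 2) → ℂ), (∀ A ∈ V, ∀ x ∈ U, A *ᵥ x ∈ U) → U = ⊥ ∨ U = ⊤) →
      Module.finrank ℂ V ≤ β₂) :
    HeavyTopInst n m := by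
  classical
  intro N hN hnil _
  -- the nilpotent space `W = ℂ·N(0) + N_lin` and its composition chain in matrix clothes
  obtain ⟨T, hT⟩ := exists_topMap_linPart N hN
  obtain ⟨P, L, lvl, hlvl, _hLm, hne, hblk, hirr⟩ :=
    exists_block_conj (((ℂ ∙ N.map (MvPolynomial.eval 0)) ⊔ LinearMap.range T : Submodule ℂ (Matrix (Fin m) (Fin m) ℂ)) :
      Set (Matrix (Fin m) (Fin m) ℂ))
  have hPW : ∀ A ∈ (ℂ ∙ N.map (MvPolynomial.eval 0)) ⊔ LinearMap.range T, ∀ i j : Fin m, lvl i < lvl j →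
      ((P : Matrix (Fin m) (Fin m) ℂ) * A * (↑P⁻¹ : Matrix (Fin m) (Fin m) ℂ)) i j = 0 := fun A hA => hblk A hA
  have hpoly := pencil_blockUpper_of_forall_mem N T hT P lvl hPW
  -- Gerstenhaber and the irreducible bounds, per block
  have hGer : ∀ (s : ℕ) (V : Submodule ℂ (Matrix (Fin s) (Fin s) ℂ)), (∀ B ∈ V, IsNilpotent B) →
      (∀ U : Submodule ℂ (Fin s → ℂ), (∀ B ∈ V, ∀ x ∈ U, B *ᵥ x ∈ U) → U = ⊥ ∨ U = ⊤) →
      Module.finrank ℂ V ≤ s.choose 2 := fun s V hV _ => finrank_le_choose_two s V hV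
  have hbound : ∀ (t : ℕ), t < L → ∀ (s : ℕ) (e : {i : Fin m // lvl i = t} ≃ Fin s) (β : ℕ),
      (∀ V : Submodule ℂ (Matrix (Fin s) (Fin s) ℂ), (∀ B ∈ V, IsNilpotent B) →
        (∀ U : Submodule ℂ (Fin s → ℂ), (∀ B ∈ V, ∀ x ∈ U, B *ᵥ x ∈ U) → U = ⊥ ∨ U = ⊤) →
        Module.finrank ℂ V ≤ β) →
      Module.finrank ℂ (Submodule.span ℂ (Set.range fun v : Fin n × Fin n → ℂ =>
        Matrix.reindex e e (((P : Matrix (Fin m) (Fin m) ℂ) * linPart N v * (↑P⁻¹ : Matrix (Fin m) (Fin m) ℂ)).toBlock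
          (fun i => lvl i = t) (fun i => lvl i = t)))) ≤ β :=
    fun t ht s e β hβ => finrank_blockSpan_le N hN hnil T hT P lvl hPW t e β hβ (hirr t ht s e)
  -- the cut profile
  have hcutL : ∀ t, L ≤ t → (Finset.univ.filter (fun i : Fin m => lvl i < t)).card = m := cut_eq_card lvl hlvl
  have hstep : ∀ t, t < L → (Finset.univ.filter (fun i : Fin m => lvl i < t)).card <
      (Finset.univ.filter (fun i : Fin m => lvl i < t + 1)).card := by
    intro t ht; rw [cut_succ]; have := hne t ht; omega
  have hL1 : 1 ≤ L := Nat.succ_le_of_lt (Nat.lt_of_le_of_lt (Nat.zero_le _) (hlvl ⟨0, by omega⟩))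
  by_cases hA : ∃ t, 2 ≤ (Finset.univ.filter (fun i : Fin m => lvl i < t)).card ∧
      (Finset.univ.filter (fun i : Fin m => lvl i < t)).card + 2 ≤ m
  · -- COARSEN at the cut `t`: two levels, Gerstenhaber
    obtain ⟨t, h2, hm2⟩ := hA
    let lvl' : Fin m → ℕ := fun i => if lvl i < t then 0 else 1
    have hlvl' : ∀ i, lvl' i < 2 := fun i => by dsimp only [lvl']; split_ifs <;> norm_num
    have hblock' : ∀ i j : Fin m, lvl' i < lvl' j →
        ((P : Matrix (Fin m) (Fin m) ℂ).map C * N * (↑P⁻¹ : Matrix (Fin m) (Fin m) ℂ).map C :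
          Matrix (Fin m) (Fin m) (MvPolynomial (Fin n × Fin n) ℂ)) i j = 0 := by
      intro i j hij
      apply hpoly i j
      dsimp only [lvl'] at hij
      split_ifs at hij with hi hj <;> omega
    have hc0 : Fintype.card {i : Fin m // lvl' i = 0} = (Finset.univ.filter (fun i : Fin m => lvl i < t)).card := by
      rw [Fintype.card_subtype]; congr 1; ext i; simp [lvl']
    have hc1 : Fintype.card {i : Fin m // lvl' i = 1} = m - (Finset.univ.filter (fun i : Fin m => lvl i < t)).card := by
      rw [Fintype.card_subtype]
      have h := Finset.card_filter_add_card_filter_not (s := (Finset.univ : Finset (Fin m))) (fun i => lvl i < t)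
      rw [Finset.card_univ, Fintype.card_fin] at h
      have h' : (Finset.univ.filter (fun i : Fin m => lvl' i = 1)) = Finset.univ.filter (fun i => ¬ lvl i < t) := by
        ext i; simp [lvl']
      rw [h']; omega
    refine flagCheap_of_invariant_levels N hN hnil P lvl' 2 (by norm_num) hlvl' hblock' ?_
    rw [Finset.sum_range_succ, Finset.sum_range_succ, Finset.sum_range_zero, zero_add, hc0, hc1]
    have := hcoarse _ h2 hm2
    omega
  · -- every cut is `≤ 1` or `≥ m − 1`: the composition is `(m)`, `(1,m−1)`, `(m−1,1)` or `(1,m−2,1)`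
    obtain ⟨a, ha⟩ : ∃ a : ℕ → ℕ, ∀ t, a t = (Finset.univ.filter (fun i : Fin m => lvl i < t)).card :=
      ⟨_, fun _ => rfl⟩
    have ha0 : a 0 = 0 := by rw [ha]; simp
    have haL : ∀ t, L ≤ t → a t = m := fun t ht => by rw [ha]; exact hcutL t ht
    have hst : ∀ t, t < L → a t < a (t + 1) := fun t ht => by rw [ha, ha]; exact hstep t ht
    have hsize : ∀ t, (Finset.univ.filter (fun i : Fin m => lvl i = t)).card = a (t + 1) - a t := by
      intro t; rw [ha, ha, cut_succ]; omega
    have hB : ∀ t, a t ≤ 1 ∨ m - 1 ≤ a t := by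
      intro t
      by_contra h
      push Not at h
      exact hA ⟨t, by rw [← ha]; omega, by rw [← ha]; omega⟩
    have ham : ∀ t, a t ≤ m := by
      intro t
      rw [ha]
      calc _ ≤ (Finset.univ : Finset (Fin m)).card := Finset.card_filter_le _ _
        _ = m := by simp
    have h1 : a 0 < a 1 := hst 0 (by omega)
    have hB1 := hB 1
    have hB2 := hB 2
    have hB3 := hB 3
    -- how many levels?
    rcases Nat.lt_or_ge L 4 with hL4 | hL4
    swap
    · -- `L ≥ 4` is impossible
      exfalso
      have h2 : a 1 < a 2 := hst 1 (by omega)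
      have h3 : a 2 < a 3 := hst 2 (by omega)
      have h4 : a 3 < a 4 := hst 3 (by omega)
      have h6 : a 4 ≤ m := ham 4
      omega
    interval_cases L
    · -- one level: the whole space is IRREDUCIBLE for `W`, size `m`
      have hs0 : (Finset.univ.filter (fun i : Fin m => lvl i = 0)).card = m := by
        rw [hsize, haL 1 le_rfl, ha0]; omega
      obtain ⟨e0⟩ := exists_level_equiv lvl 0 m hs0
      refine flagCheap_of_block_dims N hN P lvl 1 le_rfl hlvl hpoly (fun _ => β₀) (fun t => ?_) ?_
      · fin_cases t
        exact ⟨m, e0, hbound 0 (by omega) m e0 β₀ hι₀⟩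
      · rw [Finset.sum_range_one]; omega
    · -- two levels: `(1,m−1)` or `(m−1,1)`
      have hc2 : a 2 = m := haL 2 le_rfl
      have h2 : a 1 < a 2 := hst 1 (by omega)
      have hs0 : (Finset.univ.filter (fun i : Fin m => lvl i = 0)).card = a 1 - a 0 := hsize 0
      have hs1 : (Finset.univ.filter (fun i : Fin m => lvl i = 1)).card = a 2 - a 1 := hsize 1
      rcases hB1 with hlo | hhi
      · -- `(1,m−1)`
        rw [ha0] at hs0
        have hs0' : (Finset.univ.filter (fun i : Fin m => lvl i = 0)).card = 1 := by rw [hs0]; omega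
        have hs1' : (Finset.univ.filter (fun i : Fin m => lvl i = 1)).card = m - 1 := by rw [hs1]; omega
        obtain ⟨e0⟩ := exists_level_equiv lvl 0 1 hs0'
        obtain ⟨e1⟩ := exists_level_equiv lvl 1 (m - 1) hs1'
        refine flagCheap_of_block_dims N hN P lvl 2 (by norm_num) hlvl hpoly (fun t => if t = 0 then 0 else β₁)
          (fun t => ?_) ?_
        · fin_cases t
          · refine ⟨1, e0, (hbound 0 (by omega) 1 e0 (Nat.choose 1 2) (hGer 1)).trans ?_⟩
            simp
          · refine ⟨m - 1, e1, (hbound 1 (by omega) (m - 1) e1 β₁ hι₁).trans ?_⟩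
            simp
        · rw [Finset.sum_range_succ, Finset.sum_range_one]
          simp only [if_true, one_ne_zero, if_false, zero_add]
          omega
      · -- `(m−1,1)`
        rw [ha0] at hs0
        have hs0' : (Finset.univ.filter (fun i : Fin m => lvl i = 0)).card = m - 1 := by rw [hs0]; omega
        have hs1' : (Finset.univ.filter (fun i : Fin m => lvl i = 1)).card = 1 := by rw [hs1]; omega
        obtain ⟨e0⟩ := exists_level_equiv lvl 0 (m - 1) hs0'
        obtain ⟨e1⟩ := exists_level_equiv lvl 1 1 hs1'
        refine flagCheap_of_block_dims N hN P lvl 2 (by norm_num) hlvl hpoly (fun t => if t = 0 then β₁ else 0)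
          (fun t => ?_) ?_
        · fin_cases t
          · refine ⟨m - 1, e0, (hbound 0 (by omega) (m - 1) e0 β₁ hι₁).trans ?_⟩
            simp
          · refine ⟨1, e1, (hbound 1 (by omega) 1 e1 (Nat.choose 1 2) (hGer 1)).trans ?_⟩
            simp
        · rw [Finset.sum_range_succ, Finset.sum_range_one]
          simp only [if_true, one_ne_zero, if_false, add_zero]
          omega
    · -- three levels: `(1,m−2,1)`
      have h2 : a 1 < a 2 := hst 1 (by omega)
      have h3 : a 2 < a 3 := hst 2 (by omega)
      have hc3 : a 3 = m := haL 3 le_rfl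
      have hs0 : (Finset.univ.filter (fun i : Fin m => lvl i = 0)).card = 1 := by
        have h : (Finset.univ.filter (fun i : Fin m => lvl i = 0)).card = a 1 - a 0 := hsize 0
        rw [h, ha0]; omega
      have hs1 : (Finset.univ.filter (fun i : Fin m => lvl i = 1)).card = m - 2 := by
        have h : (Finset.univ.filter (fun i : Fin m => lvl i = 1)).card = a 2 - a 1 := hsize 1
        rw [h]; omega
      have hs2 : (Finset.univ.filter (fun i : Fin m => lvl i = 2)).card = 1 := by
        have h : (Finset.univ.filter (fun i : Fin m => lvl i = 2)).card = a 3 - a 2 := hsize 2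
        rw [h]; omega
      obtain ⟨e0⟩ := exists_level_equiv lvl 0 1 hs0
      obtain ⟨e1⟩ := exists_level_equiv lvl 1 (m - 2) hs1
      obtain ⟨e2⟩ := exists_level_equiv lvl 2 1 hs2
      refine flagCheap_of_block_dims N hN P lvl 3 (by norm_num) hlvl hpoly (fun t => if t = 1 then β₂ else 0)
        (fun t => ?_) ?_
      · fin_cases t
        · refine ⟨1, e0, (hbound 0 (by omega) 1 e0 (Nat.choose 1 2) (hGer 1)).trans ?_⟩
          simp
        · refine ⟨m - 2, e1, (hbound 1 (by omega) (m - 2) e1 β₂ hι₂).trans ?_⟩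
          simp
        · refine ⟨1, e2, (hbound 2 (by omega) 1 e2 (Nat.choose 1 2) (hGer 1)).trans ?_⟩
          simp
      · rw [Finset.sum_range_succ, Finset.sum_range_succ, Finset.sum_range_one]
        simp only [if_true, if_false, zero_add, add_zero, show (2 : ℕ) ≠ 1 from by decide,
          show (0 : ℕ) ≠ 1 from by decide]
        omega

/-! ## §2 One datum: the trivial bounds for the blocks of sizes `m − 1`, `m − 2` -/

/-- **`HeavyTopInst n m` from ONE irreducible-dimension datum `ι(m) ≤ β₀`** (`m ≥ 4`): the compositions `(1,m−1)`, `(m−1,1)`, `(1,m−2,1)`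
are paid with the TRIVIAL irreducible bounds `C(m−1,2) − 1`, `C(m−2,2) − 1` (✓ `finrank_le_choose_two_sub_one_of_irreducible`).
[folklore bookkeeping over Theorem G] -/
theorem heavyTopInst_of_iota_bound {n m : ℕ} (hm : 4 ≤ m) (β₀ : ℕ)
    (hcoarse : ∀ a : ℕ, 2 ≤ a → a + 2 ≤ m → 2 * n + a.choose 2 + (m - a).choose 2 < n ^ 2)
    (h₀ : n + β₀ < n ^ 2) (h₁ : 2 * n + ((m - 1).choose 2 - 1) < n ^ 2) (h₂ : 3 * n + ((m - 2).choose 2 - 1) < n ^ 2)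
    (hι₀ : ∀ V : Submodule ℂ (Matrix (Fin m) (Fin m) ℂ), (∀ A ∈ V, IsNilpotent A) →
      (∀ U : Submodule ℂ (Fin m → ℂ), (∀ A ∈ V, ∀ x ∈ U, A *ᵥ x ∈ U) → U = ⊥ ∨ U = ⊤) →
      Module.finrank ℂ V ≤ β₀) :
    HeavyTopInst n m :=
  heavyTopInst_of_iota_bounds hm β₀ ((m - 1).choose 2 - 1) ((m - 2).choose 2 - 1) hcoarse h₀ h₁ h₂ hι₀
    (fun V hV hirr => finrank_le_choose_two_sub_one_of_irreducible (by omega) V hV hirr)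
    (fun V hV hirr => finrank_le_choose_two_sub_one_of_irreducible (by omega) V hV hirr)

/-- **`HeavyTopInst n m` from ARITHMETIC alone** (`m ≥ 4`): all three irreducible bounds trivial (`C(s,2) − 1`).  Unconditional wherever
the four inequalities hold — e.g. `(15, 21)`, the boundary format of the quadratic band (`C(21,2) + 15 = 225 = 15²`).
[folklore bookkeeping over Theorem G + Gerstenhaber's equality case via the tree] -/
theorem heavyTopInst_of_trivial_bounds {n m : ℕ} (hm : 4 ≤ m)
    (hcoarse : ∀ a : ℕ, 2 ≤ a → a + 2 ≤ m → 2 * n + a.choose 2 + (m - a).choose 2 < n ^ 2)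
    (h₀ : n + (m.choose 2 - 1) < n ^ 2) (h₁ : 2 * n + ((m - 1).choose 2 - 1) < n ^ 2)
    (h₂ : 3 * n + ((m - 2).choose 2 - 1) < n ^ 2) :
    HeavyTopInst n m :=
  heavyTopInst_of_iota_bound hm (m.choose 2 - 1) hcoarse h₀ h₁ h₂
    (fun V hV hirr => finrank_le_choose_two_sub_one_of_irreducible (by omega) V hV hirr)

/-! ## §3 The coarsening budget in closed form

`C(a,2) + C(m−a,2) ≤ 1 + C(m−2,2)` for `2 ≤ a ≤ m − 2` (the two-level Gerstenhaber cost is largest at the lopsided cuts), so `hcoarse`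
is implied by the single inequality `2n + 1 + C(m−2,2) < n²`. -/

/-- Pascal for pairs: `C(a+b,2) = C(a,2) + C(b,2) + a·b`. [folklore] -/
theorem add_choose_two (a b : ℕ) : (a + b).choose 2 = a.choose 2 + b.choose 2 + a * b := by
  induction b with
  | zero => simp
  | succ b ih =>
    rw [show a + (b + 1) = (a + b) + 1 from (add_assoc a b 1).symm, Nat.choose_succ_succ, Nat.choose_one_right, ih,
      Nat.choose_succ_succ, Nat.choose_one_right]
    ring

/-- The two-level coarsening cost is maximal at the lopsided cuts: `C(a,2) + C(m−a,2) ≤ 1 + C(m−2,2)` for `2 ≤ a ≤ m − 2`.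
[folklore] -/
theorem choose_two_add_choose_two_sub_le {a m : ℕ} (ha : 2 ≤ a) (ham : a + 2 ≤ m) :
    a.choose 2 + (m - a).choose 2 ≤ 1 + (m - 2).choose 2 := by
  obtain ⟨p, rfl⟩ : ∃ p, a = p + 2 := ⟨a - 2, by omega⟩
  obtain ⟨q, rfl⟩ : ∃ q, m = p + q + 4 := ⟨m - p - 4, by omega⟩
  have e1 : p + q + 4 - (p + 2) = q + 2 := by omega
  have e2 : p + q + 4 - 2 = (p + q) + 2 := by omega
  rw [e1, e2, add_choose_two p 2, add_choose_two q 2, add_choose_two (p + q) 2, add_choose_two p q]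
  simp only [Nat.choose_self]
  nlinarith [Nat.zero_le (p * q)]

/-- **`HeavyTopInst n m` from ARITHMETIC alone, closed form** (`m ≥ 4`): the four inequalities
`2n + 1 + C(m−2,2) < n²`, `n + C(m,2) − 1 < n²`, `2n + C(m−1,2) − 1 < n²`, `3n + C(m−2,2) − 1 < n²` suffice.
[folklore bookkeeping over Theorem G + Gerstenhaber's equality case via the tree] -/
theorem heavyTopInst_of_trivial_bounds' {n m : ℕ} (hm : 4 ≤ m) (hc : 2 * n + 1 + (m - 2).choose 2 < n ^ 2)
    (h₀ : n + (m.choose 2 - 1) < n ^ 2) (h₁ : 2 * n + ((m - 1).choose 2 - 1) < n ^ 2)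
    (h₂ : 3 * n + ((m - 2).choose 2 - 1) < n ^ 2) :
    HeavyTopInst n m :=
  heavyTopInst_of_trivial_bounds hm
    (fun _ ha ham => by have := choose_two_add_choose_two_sub_le ha ham; omega) h₀ h₁ h₂

/-- **One datum, closed-form coarsening budget**: `HeavyTopInst n m` from `ι(m) ≤ β₀` and three inequalities (`m ≥ 4`).
[folklore bookkeeping over Theorem G] -/
theorem heavyTopInst_of_iota_bound' {n m : ℕ} (hm : 4 ≤ m) (β₀ : ℕ) (hc : 2 * n + 1 + (m - 2).choose 2 < n ^ 2)
    (h₀ : n + β₀ < n ^ 2) (h₁ : 2 * n + ((m - 1).choose 2 - 1) < n ^ 2) (h₂ : 3 * n + ((m - 2).choose 2 - 1) < n ^ 2)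
    (hι₀ : ∀ V : Submodule ℂ (Matrix (Fin m) (Fin m) ℂ), (∀ A ∈ V, IsNilpotent A) →
      (∀ U : Submodule ℂ (Fin m → ℂ), (∀ A ∈ V, ∀ x ∈ U, A *ᵥ x ∈ U) → U = ⊥ ∨ U = ⊤) →
      Module.finrank ℂ V ≤ β₀) :
    HeavyTopInst n m :=
  heavyTopInst_of_iota_bound hm β₀
    (fun _ ha ham => by have := choose_two_add_choose_two_sub_le ha ham; omega) h₀ h₁ h₂ hι₀

end Summit.ValiantsHypothesis.ValiantsHypothesis.Theorems.GrenetZeon.HeavyTopCompositionBound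

end
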